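import Summits.BirchSwinnertonDyer.BirchSwinnertonDyer.Theorems.ResidualThetaTransportAtTwoThetaLayerLambdaCongruenceAtTwoCuspSpanRowRelations
import HarnessLib

/-!
# Route `ResidualThetaTransportAtTwo`, cruxes Kan⁺ (stmt-BirchSwinnertonDyer-20688) / node 27436 / 21437: the INDUCTION STEP —
# if the odd rows `b = −t`, `t < m`, are killed then the row `b = −m` is killed (odd `m ≥ 3`, odd `N` prime to `3`)

Cell `bsd-wall`, width seat `bsd-wall-rtt-p3-w4` g2 (2026-08-28), memo `Cruxes/ThetaLayerLambdaCongruenceAtTwo/Lines/birth-rows-allodd.md`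
§4 (Claim C). THEOREMS ONLY; `--supports stmt-BirchSwinnertonDyer-20688`; BSD is not proved by this.

`χ : Γ₀(N) → 𝔽₂` additive, killing the small-trace elements, the `|d| = 4^k` elements and the row `B₁`; `N` odd, `3 ∤ N`;
`m ≥ 3` odd; `F` the multiplicative row character of `…CuspSpanRowConjugation` (`χ γ = F(d(γ) mod mN)` on `b(γ) = −m`).
* §1 `F` vanishes at `1`, `−1`, `2`, at `Dm − 1` for `D`, `Dm − 1` prime to `N` (`…CuspSpanRowRelations`), and — given that the row
  `b = −t` is killed — at some unit `x` with `t x ≡ −1 (mod m)` (`P ∈ B_t` with `a(P) = m − tδ₃`).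
* §2 `F` vanishes on the units `≡ 1 (mod m)`: `z = y · (z y⁻¹)` with `y = Dm − 1`, `z y⁻¹ ≡ D'm − 1`, `D' = (q + D)ŷ`,
  `q = (z − 1)/m`, and `D` chosen by CRT avoiding `{0, m⁻¹, −q}` modulo every prime of `N` (all `≥ 5`).
* §3 `F ≡ 0` on units (`z ≡ ±t` with `t` the odd one of `r, m − r`), hence **`chi_eq_zero_row_step`**: the row `b = −m` is killed.
Sequel `…CuspSpanOddLevel`: all odd rows by strong induction, parity, and the node at every odd level prime to `3`.

References: [Rademacher1929] §1; [IrelandRosen1990] Ch. 3–4; [Pollack2003] Conj. 6.3.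
-/

set_option autoImplicit false
set_option linter.dupNamespace false

noncomputable section

open scoped MatrixGroups

open CongruenceSubgroup

namespace Summit.BirchSwinnertonDyer.BirchSwinnertonDyer.Theorems.SignedMuAtTwo.Rows

variable {N : ℕ}

/-! ## §0. Small helpers -/

/-- An integer with no prime factor in common with `N` is prime to `N`. [folklore] -/
theorem isCoprime_int_of_forall_prime_not_dvd (x : ℤ) (h : ∀ ℓ : ℕ, ℓ.Prime → ℓ ∣ N → ¬ ((ℓ : ℤ) ∣ x)) : IsCoprime x (N : ℤ) := by
  rw [Int.isCoprime_iff_gcd_eq_one]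
  by_contra hg
  obtain ⟨ℓ, hℓ, hℓg⟩ := Nat.exists_prime_and_dvd hg
  have hg1 : ((Int.gcd x N : ℕ) : ℤ) ∣ x := Int.gcd_dvd_left ..
  have hg2 : ((Int.gcd x N : ℕ) : ℤ) ∣ (N : ℤ) := Int.gcd_dvd_right ..
  have h1 : (ℓ : ℤ) ∣ x := (Int.natCast_dvd_natCast.mpr hℓg).trans hg1
  have h2 : ℓ ∣ N := by
    have := (Int.natCast_dvd_natCast.mpr hℓg).trans hg2
    exact_mod_cast this
  exact h ℓ hℓ h2 h1

/-- From `¬ ℓ ∣ x` for the primes of `N` to `IsUnit (x : ZMod ℓ)`-style facts: `(x : ZMod ℓ) ≠ 0`. [folklore] -/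
theorem intCast_ne_zero_of_not_dvd {ℓ : ℕ} {x : ℤ} (h : ¬ ((ℓ : ℤ) ∣ x)) : ((x : ℤ) : ZMod ℓ) ≠ 0 := by
  rwa [Ne, ZMod.intCast_zmod_eq_zero_iff_dvd]

/-- The primes of an odd `N` prime to `3` are `≥ 5`. [folklore] -/
theorem five_le_of_mem_primeFactors (hN : Odd N) (h3N : ¬ 3 ∣ N) {ℓ : ℕ} (hℓ : ℓ ∈ N.primeFactors) : 5 ≤ ℓ := by
  have hℓp := Nat.prime_of_mem_primeFactors hℓ
  have hℓN : ℓ ∣ N := Nat.dvd_of_mem_primeFactors hℓ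
  have h2 : ℓ ≠ 2 := by rintro rfl; exact (Nat.not_even_iff_odd.mpr hN) (even_iff_two_dvd.mpr hℓN)
  have h3 : ℓ ≠ 3 := by rintro rfl; exact h3N hℓN
  have h4 : ℓ ≠ 4 := by rintro rfl; exact absurd hℓp (by decide)
  have := hℓp.two_le
  omega

variable {χ : Gamma0 N → ZMod 2}

/-! ## §1. Values of the row character -/

section Values

variable (hN : Odd N) (m : ℕ) (hm : Odd m) (hm3 : 3 ≤ m)
  (hadd : ∀ γ δ : Gamma0 N, χ (γ * δ) = χ γ + χ δ)
  (hsmall : ∀ γ : Gamma0 N, ((γ : SL(2, ℤ)) 0 0 + (γ : SL(2, ℤ)) 1 1).natAbs ≤ 2 → χ γ = 0)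
  (hkill : ∀ γ : Gamma0 N, (∃ k : ℕ, 1 ≤ k ∧ ((γ : SL(2, ℤ)) 1 1).natAbs = 4 ^ k) → χ γ = 0)
  (hB1 : ∀ β : Gamma0 N, (β : SL(2, ℤ)) 0 1 = -1 → χ β = 0)
  (F : ZMod (m * N) → ZMod 2)
  (hF : ∀ γ : Gamma0 N, (γ : SL(2, ℤ)) 0 1 = -(m : ℤ) → F ((((γ : SL(2, ℤ)) 1 1 : ℤ) : ZMod (m * N))) = χ γ)
include hN hm hadd hsmall hkill hF

/-- Multiplicativity of the row character on units (from `…CuspSpanRowConjugation`). -/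
theorem F_mul (x y : ZMod (m * N)) (hx : IsUnit x) (hy : IsUnit y) : F (x * y) = F x + F y := by
  haveI : NeZero N := ⟨hN.pos.ne'⟩
  obtain ⟨γx, bx, dx⟩ := exists_b_neg_of_isUnit m hm.pos.ne' hx
  obtain ⟨γy, by_, dy⟩ := exists_b_neg_of_isUnit m hm.pos.ne' hy
  obtain ⟨γxy, bxy, dxy⟩ := exists_b_neg_of_isUnit m hm.pos.ne' (hx.mul hy)
  have h := chi_add_chi_add_chi_eq_zero_row hN m hm hadd hsmall hkill bx by_ bxy (by rw [dxy, dx, dy])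
  rw [← dxy, ← dx, ← dy, hF γx bx, hF γy by_, hF γxy bxy]
  rw [add_eq_zero_iff_eq_neg, ZMod.neg_eq_self_mod_two] at h
  exact h.symm

/-- `F 1 = 0` (`T^{−m}`). -/
theorem F_one : F 1 = 0 := by
  haveI : NeZero N := ⟨hN.pos.ne'⟩
  obtain ⟨T, -, hT01, -, hT11⟩ :=
    ThetaLayerLambdaCongruenceAtTwo.exists_gamma0_entries (N := N) 1 (-(m : ℤ)) 0 1 (by ring) (dvd_zero _)
  have e : ((((T : SL(2, ℤ)) 1 1 : ℤ) : ZMod (m * N))) = 1 := by rw [hT11]; push_cast; rfl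
  rw [← e, hF T hT01]
  exact chi_eq_zero_of_b_neg_of_cast_eq_one hN m hm hadd hsmall hkill hT01 e

/-- `F x⁻¹ = F x` for units. -/
theorem F_inv (u : (ZMod (m * N))ˣ) : F ((u⁻¹ : (ZMod (m * N))ˣ) : ZMod (m * N)) = F (u : ZMod (m * N)) := by
  have h := F_mul hN m hm hadd hsmall hkill F hF (u : ZMod (m * N)) ((u⁻¹ : (ZMod (m * N))ˣ) : ZMod (m * N))
    (Units.isUnit _) (Units.isUnit _)
  rw [Units.mul_inv, F_one hN m hm hadd hsmall hkill F hF] at h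
  have := (add_eq_zero_iff_eq_neg.mp h.symm)
  rw [this, ZMod.neg_eq_self_mod_two]

/-- `F (−1) = 0` (`S`-companion). -/
theorem F_neg_one : F (-1) = 0 := by
  haveI : NeZero N := ⟨hN.pos.ne'⟩
  haveI : NeZero (m * N) := ⟨Nat.mul_ne_zero hm.pos.ne' (NeZero.ne N)⟩
  obtain ⟨γ₁, b1, d1⟩ := exists_b_neg_of_isUnit (N := N) m hm.pos.ne' (isUnit_one (M := ZMod (m * N)))
  obtain ⟨γ₂, b2, d2⟩ := exists_b_neg_of_isUnit (N := N) m hm.pos.ne' ((isUnit_one (M := ZMod (m * N))).neg)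
  rw [← d2, hF γ₂ b2, ← chi_eq_of_b_neg_of_mul_cast_eq_neg_one hN m hm hadd hsmall hkill b1 b2 (by rw [d1, d2]; ring),
    ← hF γ₁ b1, d1]
  exact F_one hN m hm hadd hsmall hkill F hF

include hB1

omit hkill in
/-- `F 2 = 0` (`P = T^{−(m−1)/2}`). -/
theorem F_two (hm3 : 3 ≤ m) : F 2 = 0 := by
  haveI : NeZero N := ⟨hN.pos.ne'⟩
  obtain ⟨γ, hb, hχ, hd⟩ := exists_row_d_eq_two hN hadd hsmall hB1 m hm hm3
  have e : ((((γ : SL(2, ℤ)) 1 1 : ℤ) : ZMod (m * N))) = 2 := by rw [hd]; push_cast; rfl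
  rw [← e, hF γ hb, hχ]

omit hm hsmall hkill in
/-- `F (Dm − 1) = 0` whenever `D` and `Dm − 1` are prime to `N`. -/
theorem F_mul_sub_one (D : ℤ) (hD : IsCoprime D (N : ℤ)) (hD' : IsCoprime (D * m - 1) (N : ℤ)) :
    F (((D * m - 1 : ℤ) : ZMod (m * N))) = 0 := by
  haveI : NeZero N := ⟨hN.pos.ne'⟩
  obtain ⟨A, t, hAt⟩ := hD
  -- `m − A` is prime to `N`: `(m − A) D ≡ Dm − 1`
  have hcop : IsCoprime ((m : ℤ) - A) (N : ℤ) := by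
    have e : ((m : ℤ) - A) * D = (D * m - 1) + t * N := by linear_combination -hAt
    have h1 : IsCoprime (((m : ℤ) - A) * D) (N : ℤ) := by rw [e]; exact hD'.add_mul_right_left _
    exact h1.of_mul_left_left
  obtain ⟨γ, hb, hχ, hd⟩ := exists_row_d_eq_mul_sub_one hadd hB1 (m : ℤ) D A ⟨t, by linear_combination -hAt⟩ hcop
  rw [← hd, hF γ hb, hχ]

omit hm hsmall hkill in
/-- **The auxiliary unit `x_t`.** If the row `b = −t` is killed (`t ≥ 1`, `gcd(t, m) = 1`), there is a unit `x` mod `mN` with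
`F x = 0` and `t x = Dm − 1` for some integer `D` (so `t x ≡ −1 (mod m)`). Construction: `δ₃` avoiding `{0, m/t}` modulo the
primes of `N` (all `≥ 5`), `A := m − t δ₃`, `P = (A, −t; ∗, D) ∈ B_t`, `γ = P β₃ ∈ B_m` with `t d(γ) = Dm − 1`. -/
theorem exists_F_eq_zero_aux (h3N : ¬ 3 ∣ N) (t : ℕ) (htm : Nat.Coprime t m)
    (hrow : ∀ γ : Gamma0 N, (γ : SL(2, ℤ)) 0 1 = -(t : ℤ) → χ γ = 0) :
    ∃ x : ZMod (m * N), IsUnit x ∧ F x = 0 ∧ ∃ D : ℤ, (t : ZMod (m * N)) * x = ((D * m - 1 : ℤ) : ZMod (m * N)) := by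
  haveI : NeZero N := ⟨hN.pos.ne'⟩
  have hprime5 : ∀ ℓ ∈ N.primeFactors, 5 ≤ ℓ := fun ℓ hℓ ↦ five_le_of_mem_primeFactors hN h3N hℓ
  -- choose `δ₃`
  obtain ⟨δ₃, hδ⟩ := exists_int_avoiding (N := N) (fun _ ↦ ({((1 : ℤ), (0 : ℤ)), ((t : ℤ), -(m : ℤ))} : Finset (ℤ × ℤ)))
    (by
      intro ℓ hℓ
      exact lt_of_le_of_lt (Finset.card_image_le.trans Finset.card_le_two) (by have := hprime5 ℓ hℓ; omega))
  have hmem : ∀ ℓ : ℕ, ℓ.Prime → ℓ ∣ N → ℓ ∈ N.primeFactors := fun ℓ hℓ hℓN ↦ Nat.mem_primeFactors.mpr ⟨hℓ, hℓN, hN.pos.ne'⟩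
  have hδN : IsCoprime δ₃ (N : ℤ) := by
    refine isCoprime_int_of_forall_prime_not_dvd δ₃ fun ℓ hℓ hℓN hdvd ↦ ?_
    have hℓ1 : ¬ ((ℓ : ℤ) ∣ (1 : ℤ)) := fun h ↦ hℓ.one_lt.ne' (by exact_mod_cast Int.eq_one_of_dvd_one (by positivity) h)
    have := hδ ℓ (hmem ℓ hℓ hℓN) ((1 : ℤ), (0 : ℤ)) (by simp) hℓ1
    exact this (by simpa using hdvd)
  have hAN : IsCoprime ((m : ℤ) - t * δ₃) (N : ℤ) := by
    refine isCoprime_int_of_forall_prime_not_dvd _ fun ℓ hℓ hℓN hdvd ↦ ?_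
    by_cases hℓt : (ℓ : ℤ) ∣ (t : ℤ)
    · -- then `ℓ ∣ m`, contradicting `gcd(t, m) = 1`
      have hℓm : (ℓ : ℤ) ∣ (m : ℤ) := by
        have := dvd_add hdvd (hℓt.mul_right δ₃); rwa [sub_add_cancel] at this
      have h1 : ℓ ∣ Nat.gcd t m := Nat.dvd_gcd (by exact_mod_cast hℓt) (by exact_mod_cast hℓm)
      rw [htm] at h1
      exact hℓ.one_lt.ne' (Nat.dvd_one.mp h1)
    · have := hδ ℓ (hmem ℓ hℓ hℓN) ((t : ℤ), -(m : ℤ)) (by simp) hℓt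
      apply this
      have e : (t : ℤ) * δ₃ + -(m : ℤ) = -((m : ℤ) - t * δ₃) := by ring
      rw [e]; exact hdvd.neg_right
  -- `P = (A, −t; Nκ, D)` with `A D + t N κ = 1`
  have hAtN : IsCoprime ((m : ℤ) - t * δ₃) ((t : ℤ) * N) := by
    refine IsCoprime.mul_right ?_ hAN
    have hmt : IsCoprime (m : ℤ) (t : ℤ) := Nat.isCoprime_iff_coprime.mpr htm.symm
    have e : (m : ℤ) - t * δ₃ = m + t * (-δ₃) := by ring
    rw [e]; exact hmt.add_mul_left_left _
  obtain ⟨D, κ, hDκ⟩ := hAtN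
  obtain ⟨P, p00, p01, -, p11⟩ := ThetaLayerLambdaCongruenceAtTwo.exists_gamma0_entries (N := N)
    ((m : ℤ) - t * δ₃) (-(t : ℤ)) ((N : ℤ) * κ) D (by linear_combination hDκ) (dvd_mul_right _ _)
  have hP : χ P = 0 := hrow P p01
  obtain ⟨γ, hb, hχ, hd⟩ := exists_row_of_killed hadd hB1 hP (t : ℤ) (by rw [p01]) (m : ℤ) δ₃ (by rw [p00]; ring) hδN
  refine ⟨((((γ : SL(2, ℤ)) 1 1 : ℤ) : ZMod (m * N))), ?_, by rw [hF γ hb, hχ], D, ?_⟩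
  · -- `d(γ)` is a unit mod `mN`
    have hdet := Matrix.SpecialLinearGroup.det_coe (γ : SL(2, ℤ))
    rw [Matrix.det_fin_two, hb] at hdet
    obtain ⟨c, hc⟩ : (N : ℤ) ∣ (γ : SL(2, ℤ)) 1 0 := by
      have h := γ.2; rw [Gamma0_mem] at h; exact (ZMod.intCast_zmod_eq_zero_iff_dvd _ N).mp h
    rw [hc] at hdet
    have hcopd : IsCoprime ((m * N : ℕ) : ℤ) ((γ : SL(2, ℤ)) 1 1) := by
      push_cast
      exact ⟨c, (γ : SL(2, ℤ)) 0 0, by linear_combination hdet⟩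
    exact (ZMod.coe_int_isUnit_iff_isCoprime _ (m * N)).mpr hcopd
  · rw [p11] at hd
    have e := congrArg (Int.cast : ℤ → ZMod (m * N)) hd
    push_cast at e ⊢
    exact e

/-! ## §2. `F` vanishes on the units `≡ 1 (mod m)` -/

/-- **`F z = 0` for units `z ≡ 1 (mod m)`** (`3 ∤ N`): `z = (z ŷ) · y` with `y = Dm − 1`, `z ŷ ≡ D'm − 1`, `D' = (q + D) ŷ`,
`q = (z − 1)/m`, `D ∉ {0, m⁻¹, −q}` modulo the primes of `N`. -/
theorem F_eq_zero_of_cast_eq_one (h3N : ¬ 3 ∣ N) (z : ZMod (m * N)) (hz : IsUnit z)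
    (hz1 : ZMod.castHom (dvd_mul_right m N) (ZMod m) z = 1) : F z = 0 := by
  haveI : NeZero N := ⟨hN.pos.ne'⟩
  have hm0 : m ≠ 0 := hm.pos.ne'
  haveI : NeZero (m * N) := ⟨Nat.mul_ne_zero hm0 (NeZero.ne N)⟩
  haveI : NeZero m := ⟨hm0⟩
  -- integer representative and `q`
  set zi : ℤ := (z.val : ℤ) with hzi
  have hzcast : ((zi : ℤ) : ZMod (m * N)) = z := by rw [hzi, Int.cast_natCast, ZMod.natCast_zmod_val]
  obtain ⟨q, hq⟩ : (m : ℤ) ∣ zi - 1 := by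
    rw [← ZMod.intCast_zmod_eq_zero_iff_dvd]
    have e : ((zi : ℤ) : ZMod m) = ZMod.castHom (dvd_mul_right m N) (ZMod m) z := by rw [← hzcast, map_intCast]
    push_cast; rw [e, hz1, sub_self]
  have hzN : IsCoprime zi (N : ℤ) := by
    have h := (ZMod.coe_int_isUnit_iff_isCoprime zi (m * N)).mp (by rw [hzcast]; exact hz)
    push_cast at h
    exact h.symm.of_mul_right_right
  -- choose `D`
  have hmem : ∀ ℓ : ℕ, ℓ.Prime → ℓ ∣ N → ℓ ∈ N.primeFactors := fun ℓ hℓ hℓN ↦ Nat.mem_primeFactors.mpr ⟨hℓ, hℓN, hN.pos.ne'⟩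
  obtain ⟨D, hD⟩ := exists_int_avoiding (N := N)
    (fun _ ↦ ({((1 : ℤ), (0 : ℤ)), ((m : ℤ), (-1 : ℤ)), ((1 : ℤ), q)} : Finset (ℤ × ℤ)))
    (by
      intro ℓ hℓ
      exact lt_of_le_of_lt (Finset.card_image_le.trans Finset.card_le_three)
        (by have := five_le_of_mem_primeFactors hN h3N hℓ; omega))
  have hone : ∀ ℓ : ℕ, ℓ.Prime → ¬ ((ℓ : ℤ) ∣ (1 : ℤ)) := fun ℓ hℓ h ↦
    hℓ.one_lt.ne' (by exact_mod_cast Int.eq_one_of_dvd_one (by positivity) h)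
  have hDN : IsCoprime D (N : ℤ) := isCoprime_int_of_forall_prime_not_dvd D fun ℓ hℓ hℓN hdvd ↦
    hD ℓ (hmem ℓ hℓ hℓN) ((1 : ℤ), (0 : ℤ)) (by simp) (hone ℓ hℓ) (by simpa using hdvd)
  have hyN : IsCoprime (D * m - 1) (N : ℤ) := by
    refine isCoprime_int_of_forall_prime_not_dvd _ fun ℓ hℓ hℓN hdvd ↦ ?_
    by_cases hℓm : (ℓ : ℤ) ∣ (m : ℤ)
    · have : (ℓ : ℤ) ∣ 1 := by
        have := Int.dvd_sub (hℓm.mul_left D) hdvd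
        rwa [show D * (m : ℤ) - (D * m - 1) = 1 by ring] at this
      exact hone ℓ hℓ this
    · exact hD ℓ (hmem ℓ hℓ hℓN) ((m : ℤ), (-1 : ℤ)) (by simp) hℓm (by rw [show (m : ℤ) * D + -1 = D * m - 1 by ring]; exact hdvd)
  have hqDN : IsCoprime (q + D) (N : ℤ) := isCoprime_int_of_forall_prime_not_dvd _ fun ℓ hℓ hℓN hdvd ↦
    hD ℓ (hmem ℓ hℓ hℓN) ((1 : ℤ), q) (by simp) (hone ℓ hℓ) (by rw [show (1 : ℤ) * D + q = q + D by ring]; exact hdvd)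
  -- `y = Dm − 1` is a unit mod `mN`; its inverse `ŷ`
  have hymN : IsCoprime (D * m - 1) ((m * N : ℕ) : ℤ) := by
    push_cast
    refine IsCoprime.mul_right ?_ hyN
    exact ⟨-1, D, by ring⟩
  obtain ⟨yh, w, hyh⟩ := hymN
  have hyhN : IsCoprime yh (N : ℤ) := by
    have : IsCoprime yh ((m * N : ℕ) : ℤ) := ⟨D * m - 1, w, by linear_combination hyh⟩
    push_cast at this
    exact this.of_mul_right_right
  -- `F y = 0` and `F (D'm − 1) = 0` with `D' = (q + D) ŷ`
  have hFy : F (((D * m - 1 : ℤ)) : ZMod (m * N)) = 0 := F_mul_sub_one hN m hadd hB1 F hF D hDN hyN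
  have hD'N : IsCoprime ((q + D) * yh) (N : ℤ) := hqDN.mul_left hyhN
  push_cast at hyh
  have hident : (q + D) * yh * m - 1 = yh * zi + (-(w * m)) * N := by
    have e1 : (q + D) * (m : ℤ) = zi + (D * m - 1) := by linear_combination -hq
    linear_combination yh * e1 + hyh
  have hD'N' : IsCoprime ((q + D) * yh * m - 1) (N : ℤ) := by
    rw [hident]
    exact (hyhN.mul_left hzN).add_mul_right_left _
  have hFy' : F ((((q + D) * yh * m - 1 : ℤ)) : ZMod (m * N)) = 0 := F_mul_sub_one hN m hadd hB1 F hF _ hD'N hD'N'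
  -- assemble: `z = (z ŷ) · y`
  have hmn0 : (m : ZMod (m * N)) * (N : ZMod (m * N)) = 0 := by rw [← Nat.cast_mul, ZMod.natCast_self]
  have hcast1 : ((((q + D) * yh * m - 1 : ℤ)) : ZMod (m * N)) = z * ((yh : ℤ) : ZMod (m * N)) := by
    rw [hident]; push_cast; rw [hzcast]; linear_combination (-(w : ZMod (m * N))) * hmn0
  have hyy : ((yh : ℤ) : ZMod (m * N)) * (((D * m - 1 : ℤ)) : ZMod (m * N)) = 1 := by
    have e := congrArg (Int.cast : ℤ → ZMod (m * N)) hyh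
    push_cast at e ⊢
    linear_combination e - (w : ZMod (m * N)) * hmn0
  have hyu : IsUnit (((D * m - 1 : ℤ)) : ZMod (m * N)) :=
    IsUnit.of_mul_eq_one ((yh : ℤ) : ZMod (m * N)) ((mul_comm _ _).trans hyy)
  have hyhu : IsUnit (((yh : ℤ)) : ZMod (m * N)) := IsUnit.of_mul_eq_one _ hyy
  have e : z = (z * ((yh : ℤ) : ZMod (m * N))) * (((D * m - 1 : ℤ)) : ZMod (m * N)) := by
    rw [mul_assoc, hyy, mul_one]
  rw [e, F_mul hN m hm hadd hsmall hkill F hF _ _ (hz.mul hyhu) hyu, ← hcast1, hFy', hFy, add_zero]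

/-! ## §3. `F ≡ 0` on units; the row `b = −m` is killed -/

/-- **`F ≡ 0` on the units of `ℤ/mN`** (`3 ∤ N`), given that every odd row `b = −t`, `t < m`, is killed. -/
theorem F_eq_zero_of_isUnit (h3N : ¬ 3 ∣ N) (hm3 : 3 ≤ m)
    (IH : ∀ t : ℕ, Odd t → t < m → ∀ γ : Gamma0 N, (γ : SL(2, ℤ)) 0 1 = -(t : ℤ) → χ γ = 0)
    (z : ZMod (m * N)) (hz : IsUnit z) : F z = 0 := by
  haveI : NeZero N := ⟨hN.pos.ne'⟩
  have hm0 : m ≠ 0 := hm.pos.ne'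
  haveI : NeZero (m * N) := ⟨Nat.mul_ne_zero hm0 (NeZero.ne N)⟩
  haveI : NeZero m := ⟨hm0⟩
  set π := ZMod.castHom (dvd_mul_right m N) (ZMod m) with hπ
  set r : ℕ := (π z).val with hr
  have hrm : r < m := ZMod.val_lt _
  have hrcast : ((r : ℕ) : ZMod m) = π z := ZMod.natCast_zmod_val _
  have hru : IsUnit (π z) := hz.map π
  have hrcop : Nat.Coprime r m := by
    have h := ZMod.val_coe_unit_coprime hru.unit
    rwa [IsUnit.unit_spec] at h
  have hr0 : r ≠ 0 := by
    intro h0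
    have : Nat.Coprime 0 m := h0 ▸ hrcop
    rw [Nat.coprime_zero_left] at this
    omega
  -- the odd one of `r`, `m − r`
  obtain ⟨t, htodd, htm, htcop, hsign⟩ : ∃ t : ℕ, Odd t ∧ t < m ∧ Nat.Coprime t m ∧
      (π z = (t : ZMod m) ∨ π z = -(t : ZMod m)) := by
    rcases Nat.even_or_odd r with he | ho
    · refine ⟨m - r, ?_, by omega, ?_, Or.inr ?_⟩
      · exact (Nat.odd_sub hrm.le).mpr ⟨fun _ ↦ he, fun _ ↦ hm⟩
      · exact (Nat.coprime_self_sub_left hrm.le).mpr hrcop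
      · rw [← hrcast, Nat.cast_sub hrm.le, ZMod.natCast_self, zero_sub, neg_neg]
    · exact ⟨r, ho, hrm, hrcop, Or.inl hrcast.symm⟩
  obtain ⟨x, hxu, hFx, D, hD⟩ := exists_F_eq_zero_aux hN m hadd hB1 F hF h3N t htcop (IH t htodd htm)
  -- `t · π x = −1`
  have htx : (t : ZMod m) * π x = -1 := by
    have e := congrArg π hD
    rw [map_mul, map_natCast, map_intCast] at e
    rw [e]; push_cast; rw [ZMod.natCast_self, mul_zero, zero_sub]
  have hFinv : F ((hxu.unit⁻¹ : (ZMod (m * N))ˣ) : ZMod (m * N)) = 0 := by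
    rw [F_inv hN m hm hadd hsmall hkill F hF, IsUnit.unit_spec]; exact hFx
  have hxi : x * ((hxu.unit⁻¹ : (ZMod (m * N))ˣ) : ZMod (m * N)) = 1 := IsUnit.mul_val_inv hxu
  rcases hsign with hpos | hneg
  · -- `π z = t`: `π(−(z x)) = 1`
    have h1 : π (-(z * x)) = 1 := by rw [map_neg, map_mul, hpos, htx, neg_neg]
    have h0 := F_eq_zero_of_cast_eq_one hN m hm hadd hsmall hkill hB1 F hF h3N (-(z * x)) ((hz.mul hxu).neg) h1
    have e : z = (-1) * (-(z * x)) * ((hxu.unit⁻¹ : (ZMod (m * N))ˣ) : ZMod (m * N)) := by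
      rw [neg_mul_neg, one_mul, mul_assoc, hxi, mul_one]
    rw [e, F_mul hN m hm hadd hsmall hkill F hF _ _ ((isUnit_one.neg).mul ((hz.mul hxu).neg)) (Units.isUnit _),
      F_mul hN m hm hadd hsmall hkill F hF _ _ (isUnit_one.neg) ((hz.mul hxu).neg),
      F_neg_one hN m hm hadd hsmall hkill F hF, h0, hFinv, add_zero, add_zero]
  · -- `π z = −t`: `π(z x) = 1`
    have h1 : π (z * x) = 1 := by rw [map_mul, hneg, neg_mul, htx, neg_neg]
    have h0 := F_eq_zero_of_cast_eq_one hN m hm hadd hsmall hkill hB1 F hF h3N (z * x) (hz.mul hxu) h1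
    have e : z = (z * x) * ((hxu.unit⁻¹ : (ZMod (m * N))ˣ) : ZMod (m * N)) := by rw [mul_assoc, hxi, mul_one]
    rw [e, F_mul hN m hm hadd hsmall hkill F hF _ _ (hz.mul hxu) (Units.isUnit _), h0, hFinv, add_zero]

end Values

/-- **The induction step.** `N` odd with `3 ∤ N`; `χ` additive, killing the small-trace elements, the `|d| = 4^k` elements and
the row `b = −1`; `m ≥ 3` odd; every row `b = −t` with `t` odd, `t < m` killed. Then the row `b = −m` is killed.
[cite: Pollack2003, Conj. 6.3] -/
theorem chi_eq_zero_row_step (hN : Odd N) (h3N : ¬ 3 ∣ N) (m : ℕ) (hm : Odd m) (hm3 : 3 ≤ m)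
    (hadd : ∀ γ δ : Gamma0 N, χ (γ * δ) = χ γ + χ δ)
    (hsmall : ∀ γ : Gamma0 N, ((γ : SL(2, ℤ)) 0 0 + (γ : SL(2, ℤ)) 1 1).natAbs ≤ 2 → χ γ = 0)
    (hkill : ∀ γ : Gamma0 N, (∃ k : ℕ, 1 ≤ k ∧ ((γ : SL(2, ℤ)) 1 1).natAbs = 4 ^ k) → χ γ = 0)
    (hB1 : ∀ β : Gamma0 N, (β : SL(2, ℤ)) 0 1 = -1 → χ β = 0)
    (IH : ∀ t : ℕ, Odd t → t < m → ∀ γ : Gamma0 N, (γ : SL(2, ℤ)) 0 1 = -(t : ℤ) → χ γ = 0) :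
    ∀ γ : Gamma0 N, (γ : SL(2, ℤ)) 0 1 = -(m : ℤ) → χ γ = 0 := by
  classical
  haveI : NeZero N := ⟨hN.pos.ne'⟩
  have hm0 : m ≠ 0 := hm.pos.ne'
  haveI : NeZero (m * N) := ⟨Nat.mul_ne_zero hm0 (NeZero.ne N)⟩
  -- the row character
  let F : ZMod (m * N) → ZMod 2 := fun r ↦ if h : IsUnit r then χ (Classical.choose (exists_b_neg_of_isUnit (N := N) m hm0 h)) else 0
  have hF : ∀ γ : Gamma0 N, (γ : SL(2, ℤ)) 0 1 = -(m : ℤ) → F ((((γ : SL(2, ℤ)) 1 1 : ℤ) : ZMod (m * N))) = χ γ := by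
    intro γ hb
    have hdet := Matrix.SpecialLinearGroup.det_coe (γ : SL(2, ℤ))
    rw [Matrix.det_fin_two, hb] at hdet
    obtain ⟨c, hc⟩ : (N : ℤ) ∣ (γ : SL(2, ℤ)) 1 0 := by
      have h := γ.2; rw [Gamma0_mem] at h; exact (ZMod.intCast_zmod_eq_zero_iff_dvd _ N).mp h
    rw [hc] at hdet
    have hu : IsUnit ((((γ : SL(2, ℤ)) 1 1 : ℤ) : ZMod (m * N))) := by
      refine (ZMod.coe_int_isUnit_iff_isCoprime _ (m * N)).mpr ?_
      push_cast
      exact ⟨c, (γ : SL(2, ℤ)) 0 0, by linear_combination hdet⟩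
    have hs := Classical.choose_spec (exists_b_neg_of_isUnit (N := N) m hm0 hu)
    simp only [F, dif_pos hu]
    exact chi_eq_of_b_neg_of_cast_eq hN m hm hadd hsmall hkill hs.1 hb hs.2
  intro γ hb
  rw [← hF γ hb]
  refine F_eq_zero_of_isUnit hN m hm hadd hsmall hkill hB1 F hF h3N hm3 IH _ ?_
  -- `d(γ)` is a unit mod `mN`
  have hdet := Matrix.SpecialLinearGroup.det_coe (γ : SL(2, ℤ))
  rw [Matrix.det_fin_two, hb] at hdet
  obtain ⟨c, hc⟩ : (N : ℤ) ∣ (γ : SL(2, ℤ)) 1 0 := by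
    have h := γ.2; rw [Gamma0_mem] at h; exact (ZMod.intCast_zmod_eq_zero_iff_dvd _ N).mp h
  rw [hc] at hdet
  refine (ZMod.coe_int_isUnit_iff_isCoprime _ (m * N)).mpr ?_
  push_cast
  exact ⟨c, (γ : SL(2, ℤ)) 0 0, by linear_combination hdet⟩



end Summit.BirchSwinnertonDyer.BirchSwinnertonDyer.Theorems.SignedMuAtTwo.Rows

end
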